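import Summits.Ventures.CertifiedManyBodySolver.Rows.CorrWindowCertKernelChainQuotAdjFastMaps
import HarnessLib

/-!
# Fast chain step, part 3: the step SPECIALISED to a box geometry — `stepEQAFB r R vmax B C T H = stepEQA (boxQuot r R vmax) B C T H`

The measured lever (captain R-g4-12 (L7)): hint targets through the closed-form move `gqN`, the quotient through the closed-form
push `pushN`, NO re-check of `hintTgt` inside the merge-walk (every row `hintRows` emits is GOOD — licensed, and its target IS its
monomial — so `rowOK` reduces to the monomial match and the nonzero sign: `annotateG_eq`), the raw slice through the parity engine,
and the `Mono.word` re-normalisations through `monoNF`. The equation `stepEQAFB_eq` is unconditional (the function falls back to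
`stepEQA` when `r + vmax > R`). CHAIN-FILE TEMPLATE at geometry `def D := boxQuot 6 13 7`:
`theorem step_s : C' = stepEQA D 2048 C (slices.getD s []) (hintsOfCodes Dr reps HC_s) := stepEQAFB_kernel 6 13 7 rfl (by decide +kernel)`.
MEASURED on hubbard-algo-p2's real inline chain-1 twin (`W3v3_Inline_chain1_R13.lean`, 5 steps, 5 917 products, same farm node,
back to back): 386.6 s → 261.9 s with §1–§5 of parts 1–3 except the parity engine (kernel 364 s → 239 s, ×1.52); see the seat's bus line
for the final number with the parity engine.

HONEST FRAMING (xx1): Lean plumbing towards «tier P» — a PROOF-TERM-only speed-up of the kernel replay of chain steps; every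
`step_s` statement, every accumulator literal, every census/EQUAL artefact, `ChainQAOK`/`StepsQA`/Assembly/closer stays byte-identical.
Nothing of record moves; no certificate is evaluated here; no claim node is discharged; CONTROL/CALIBRATION context; silent on the
presence of superconductivity; not a `T_c` or phase sentence; nothing about any material; no summit statement is proved by this file.
Cell `hubbard-obs` × `hubbard-downfold` (D-0154 (1)(C) La214), seat hubbard-cov-la214-box-2 g5 (`prover-hubbard-cov-la214-box-2-g5-0`),
lever (L7) of captain ruling R-g4-12 (obs-p2 GO 2026-08-29T02:25:48Z), zero compute.

References: C. Jansson, D. Chaykin, C. Keil, SIAM J. Numer. Anal. 46 (2008) 180 [JanssonChaykinKeil2008]; X. Han, arXiv:2006.06002 §3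
[Han2020Bootstrap]; O. Bratteli, D. W. Robinson, *Operator Algebras and Quantum Statistical Mechanics 2* §5.2.2 [BratteliRobinsonII1997].
-/

namespace Summit.Ventures.CertifiedManyBodySolver

namespace CARPolyWindow

open Summit.Ventures.CertifiedQuantumChemistry Summit.Ventures.CertifiedQuantumChemistry.CARPoly
open Literature.MathematicalPhysics.QuantumLattice Literature.MathematicalPhysics.QuantumLattice.HubbardWave0

/-! ## §1 The box fast step -/

section BoxStep

open BoxGeom

variable (r R vmax : ℕ)

/-- Fast `hintTgt` at a box geometry (closed-form move). [cite: Han2020Bootstrap, §3] -/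
def hintTgtB (B : ℕ) (h : QHint (boxN r)) : CARPoly.Poly (Orb (Fin (boxN R))) :=
  normalizeM SOSDual.encL B [(mapMono (gqN r R vmax h.γ (h.v.1 + vmax).toNat (h.v.2 + vmax).toNat) h.μ, 1)]

/-- `hintTgtB` IS `hintTgt` at the box geometry, on licensed hints. [folklore] -/
theorem hintTgtB_eq (hR : r + vmax ≤ R) (B : ℕ) (h : QHint (boxN r)) (hok : boxOk vmax h.γ h.v = true) :
    hintTgtB r R vmax B h = hintTgt (boxQuot r R vmax) B h := by
  rw [← hintTgtF_eq, hintTgtF, hintTgtB]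
  have e : gqN r R vmax h.γ (h.v.1 + vmax).toNat (h.v.2 + vmax).toNat =
      gq (boxQuot r R vmax) (d4OfCode h.γ) (siteOfPair h.v) := funext fun b => gqN_eq hR h.γ h.v hok b
  rw [e]

/-- Fast `hintRows` at a box geometry. [folklore] -/
def hintRowsB (B : ℕ) (H : List (QHint (boxN r))) : List (HRow (boxN R) (boxN r)) :=
  H.filterMap fun h =>
    if boxOk vmax h.γ h.v then
      match hintTgtB r R vmax B h with
      | [(m, ε)] => some (CARPoly.Mono.key SOSDual.encL B m, (m, (ε, h)))
      | _ => none
    else none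

/-- `hintRowsB` IS `hintRows` at the box geometry. [folklore] -/
theorem hintRowsB_eq (hR : r + vmax ≤ R) (B : ℕ) (H : List (QHint (boxN r))) :
    hintRowsB r R vmax B H = hintRows (boxQuot r R vmax) B H := by
  induction H with
  | nil => rfl
  | cons h H ih =>
    simp only [hintRowsB, hintRows, List.filterMap_cons] at ih ⊢
    rw [ih]
    have hok : (boxQuot r R vmax).ok h.γ h.v = boxOk vmax h.γ h.v := rfl
    rw [hok]
    cases hb : boxOk vmax h.γ h.v with
    | false => rfl
    | true =>
      rw [if_pos rfl, if_pos rfl, hintTgtB_eq r R vmax hR B h hb]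
      rcases hh : hintTgt (boxQuot r R vmax) B h with _ | ⟨⟨m, ε⟩, _ | ⟨b, l⟩⟩ <;> rfl

/-- Fast zero-class test at a box geometry (closed-form push). [cite: Han2020Bootstrap, §3] -/
def zeroQB (B : ℕ) (m : CARPoly.Mono (Orb (Fin (boxN R)))) (e : ℚ × QHint (boxN r)) : Bool :=
  decide (e.1 = -1) && decide (normalizeM SOSDual.encL B [(mapMono (pushN r R) e.2.μ, 1)] = [(m, 1)])

/-- The closed-form push IS the geometry's push `f`. [folklore] -/
theorem pushN_eq_f (hR : r ≤ R) : pushN r R = (boxQuot r R vmax).f := funext fun b => pushN_eq hR b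

/-- `zeroQB` IS `zeroQ` at the box geometry. [folklore] -/
theorem zeroQB_eq (hR : r ≤ R) (B : ℕ) (m : CARPoly.Mono (Orb (Fin (boxN R)))) (e : ℚ × QHint (boxN r)) :
    zeroQB r R B m e = zeroQ (boxQuot r R vmax) B m e := by
  rw [← zeroQF_eq, zeroQF, zeroQB, pushN_eq_f r R vmax hR]

/-- The quotiented (monomial, coefficient) list at a box geometry (closed-form push, computed once per term).
[cite: Han2020Bootstrap, §3] -/
def quotOutZMB (B : ℕ) (A : List (ATerm (boxN R) (boxN r))) : List (CARPoly.Mono (Orb (Fin (boxN R))) × ℚ) :=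
  A.flatMap fun a => match a.2 with
    | none => [(a.1.1, a.1.2)]
    | some e =>
      let μ' := mapMono (pushN r R) e.2.μ
      if decide (e.1 = -1) && decide (normalizeM SOSDual.encL B [(μ', 1)] = [(a.1.1, 1)]) then [] else [(μ', a.1.2 / e.1)]

/-- `quotOutZMB` IS `quotOutZM` at the box geometry. [folklore] -/
theorem quotOutZMB_eq (hR : r ≤ R) (B : ℕ) (A : List (ATerm (boxN R) (boxN r))) :
    quotOutZMB r R B A = quotOutZM (boxQuot r R vmax) B A := by
  unfold quotOutZMB quotOutZM
  congr 1
  funext a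
  rcases a with ⟨⟨m, c⟩, _ | e⟩
  · rfl
  · dsimp only
    rw [pushN_eq_f r R vmax hR, zeroQF]

/-- A hint row is GOOD when it is licensed and its hint's target IS its monomial with its sign — true of every row `hintRows`
emits, so that `rowOK`'s re-check of `hintTgt` on such rows is redundant. [folklore] -/
def RowGood {N Nβ : ℕ} (D : QuotData N Nβ) (B : ℕ) (ρ : HRow N Nβ) : Prop :=
  D.ok ρ.2.2.2.γ ρ.2.2.2.v = true ∧ hintTgt D B ρ.2.2.2 = [(ρ.2.1, ρ.2.2.1)]

/-- Every row `hintRows` emits is good. [folklore] -/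
theorem hintRows_good {N Nβ : ℕ} (D : QuotData N Nβ) (B : ℕ) :
    ∀ (H : List (QHint Nβ)), ∀ ρ ∈ hintRows D B H, RowGood D B ρ
  | [], ρ, hρ => by simp [hintRows] at hρ
  | h :: H, ρ, hρ => by
    rw [hintRows, List.filterMap_cons] at hρ
    have ih := hintRows_good D B H ρ
    rw [hintRows] at ih
    split at hρ
    · rename_i hnone
      exact ih hρ
    · rename_i ρ' hsome
      rcases List.mem_cons.1 hρ with rfl | hρ
      · split_ifs at hsome with hok
        split at hsome
        · rename_i m ε htgt
          simp only [Option.some.injEq] at hsome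
          subst hsome
          exact ⟨hok, htgt⟩
        · simp at hsome
      · exact ih hρ

/-- `dropBehind` only drops. [folklore] -/
theorem dropBehind_sublist {N Nβ : ℕ} (k : ℕ) : ∀ (R : List (HRow N Nβ)), ∀ ρ ∈ dropBehind k R, ρ ∈ R
  | [], ρ, h => h
  | r :: R, ρ, h => by
    rw [dropBehind] at h
    split_ifs at h
    · exact List.mem_cons_of_mem _ (dropBehind_sublist k R ρ h)
    · exact h

/-- `rowOK` WITHOUT the re-check (monomial match and nonzero sign only). [folklore] -/
def rowOKG {N Nβ : ℕ} (m : CARPoly.Mono (Orb (Fin N))) (ρ : HRow N Nβ) : Bool :=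
  decide (ρ.2.1 = m) && !decide (ρ.2.2.1 = 0)

/-- On a good row the re-check passes: `rowOKG` IS `rowOK`. [folklore] -/
theorem rowOKG_eq {N Nβ : ℕ} (D : QuotData N Nβ) (B : ℕ) (m : CARPoly.Mono (Orb (Fin N))) (ρ : HRow N Nβ) (hρ : RowGood D B ρ) :
    rowOKG m ρ = rowOK D B m ρ := by
  obtain ⟨hok, htgt⟩ := hρ
  unfold rowOKG rowOK
  rw [hok, htgt]
  by_cases hm : ρ.2.1 = m
  · subst hm; simp
  · simp [hm]

/-- `annotate` WITHOUT the re-check. [folklore] -/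
def annotateG {N Nβ : ℕ} (B : ℕ) : CARPoly.Poly (Orb (Fin N)) → List (HRow N Nβ) → List (ATerm N Nβ)
  | [], _ => []
  | t :: P, ρs =>
    match dropBehind (CARPoly.Mono.key SOSDual.encL B t.1) ρs with
    | [] => (t, none) :: annotateG B P []
    | ρ :: ρs' => if rowOKG t.1 ρ then (t, some ρ.2.2) :: annotateG B P ρs' else (t, none) :: annotateG B P (ρ :: ρs')

/-- On GOOD rows the re-check is redundant. [folklore] -/
theorem annotateG_eq {N Nβ : ℕ} (D : QuotData N Nβ) (B : ℕ) : ∀ (P : CARPoly.Poly (Orb (Fin N))) (ρs : List (HRow N Nβ)),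
    (∀ ρ ∈ ρs, RowGood D B ρ) → annotateG B P ρs = annotate D B P ρs
  | [], ρs, _ => by rw [annotateG, annotate]
  | t :: P, ρs, hρs => by
    rw [annotateG, annotate]
    have hsub := dropBehind_sublist (CARPoly.Mono.key SOSDual.encL B t.1) ρs
    cases hd : dropBehind (CARPoly.Mono.key SOSDual.encL B t.1) ρs with
    | nil => simp only [annotateG_eq D B P [] (fun _ h => by simp at h)]
    | cons ρ ρs' =>
      rw [hd] at hsub
      have hρ : RowGood D B ρ := hρs ρ (hsub ρ List.mem_cons_self)
      have hρs' : ∀ x ∈ ρs', RowGood D B x := fun x hx => hρs x (hsub x (List.mem_cons_of_mem _ hx))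
      have hρρs' : ∀ x ∈ ρ :: ρs', RowGood D B x := fun x hx => hρs x (hsub x hx)
      simp only [rowOKG_eq D B t.1 ρ hρ, annotateG_eq D B P ρs' hρs', annotateG_eq D B P (ρ :: ρs') hρρs']

/-- Sorting keeps rows good. [folklore] -/
theorem sortByKey_good {N Nβ : ℕ} (D : QuotData N Nβ) (B : ℕ) (L : List (HRow N Nβ)) (hL : ∀ ρ ∈ L, RowGood D B ρ) :
    ∀ ρ ∈ sortByKey L, RowGood D B ρ := fun ρ hρ => hL ρ ((CARPoly.sortByKey_perm L).subset hρ)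

/-- **The fast step at a box geometry** (falls back to `stepEQA` when `r + vmax > R`, so that the equation below is
unconditional). [cite: JanssonChaykinKeil2008, §3] [cite: Han2020Bootstrap, §3] -/
def stepEQAFB (B : ℕ) (C : SOSDual.EncPoly) (T : Terms (Orb (Fin (boxN R)))) (H : List (QHint (boxN r))) : SOSDual.EncPoly :=
  if r + vmax ≤ R then
    let A := annotateG B (normalizeS SOSDual.encL B T) (sortByKey (hintRowsB r R vmax B H))
    let P1 := normalizeM SOSDual.encL B (quotOutZMB r R B A)
    SOSDual.mergeE B C (SOSDual.encPoly (normalizeM SOSDual.encL B (adjOutM B P1)))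
  else stepEQA (boxQuot r R vmax) B C T H

/-- **The box fast step IS the step at `boxQuot r R vmax`.** A chain file at geometry `(r, R, vmax)` with
`def D := boxQuot r R vmax` proves its kernel fact `C' = stepEQA D B C T H` by
`by rw [← stepEQAFB_eq r R vmax]; exact eq_of_beq (by decide +kernel)`. [folklore] -/
theorem stepEQAFB_eq (B : ℕ) (C : SOSDual.EncPoly) (T : Terms (Orb (Fin (boxN R)))) (H : List (QHint (boxN r))) :
    stepEQAFB r R vmax B C T H = stepEQA (boxQuot r R vmax) B C T H := by
  unfold stepEQAFB
  split_ifs with hR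
  · have hr : r ≤ R := le_trans (Nat.le_add_right r vmax) hR
    rw [← stepEQAF_eq, stepEQAF]
    dsimp only
    have hgood := sortByKey_good (boxQuot r R vmax) B _ (hintRows_good (boxQuot r R vmax) B H)
    rw [normalizeS_eq, hintRowsB_eq r R vmax hR, annotateG_eq (boxQuot r R vmax) B _ _ hgood, quotOutZMB_eq r R vmax hr,
      annotateF_eq, hintRowsF_eq]
  · rfl

/-- The same equation against a geometry given BY NAME (`hD : D = boxQuot r R vmax`, e.g. `rfl` for a chain file's `def D`). [folklore] -/
theorem stepEQAFB_eq' {D : QuotData (boxN R) (boxN r)} (hD : D = boxQuot r R vmax) (B : ℕ) (C : SOSDual.EncPoly)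
    (T : Terms (Orb (Fin (boxN R)))) (H : List (QHint (boxN r))) :
    stepEQAFB r R vmax B C T H = stepEQA D B C T H := by
  rw [hD]; exact stepEQAFB_eq r R vmax B C T H

/-- **THE CHAIN-FILE ENTRY POINT.** A kernel fact `C' = stepEQA D B C T H` of a chain file at geometry `D = boxQuot r R vmax`
(by name, `hD := rfl`) from the Boolean evaluation of the FAST step:
`theorem step_s : C' = stepEQA D 2048 C T H := stepEQAFB_kernel 6 13 7 rfl (by decide +kernel)`. [folklore] -/
theorem stepEQAFB_kernel {D : QuotData (boxN R) (boxN r)} (hD : D = boxQuot r R vmax) {B : ℕ} {C C' : SOSDual.EncPoly}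
    {T : Terms (Orb (Fin (boxN R)))} {H : List (QHint (boxN r))} (h : (C' == stepEQAFB r R vmax B C T H) = true) :
    C' = stepEQA D B C T H :=
  (eq_of_beq h).trans (stepEQAFB_eq' r R vmax hD B C T H)

end BoxStep

end CARPolyWindow

end Summit.Ventures.CertifiedManyBodySolver
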